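import Literature.NumberTheory.LFunctions.ClassGroupLFunctionZeroFreeRegion
import Literature.NumberTheory.LFunctions.RayClassLSeriesNonvanishing
import HarnessLib

/-!
# Real zeros of class group `L`-functions near `s = 1`: "at most one", uniformly in the field

Topic `Literature/NumberTheory/LFunctions` (namespaces `Literature.NumberTheory.LFunctions.UniformTwistedZFRData`
for the abstract part, `Literature.NumberTheory.LFunctions.NumberField` for class group characters).
Everything in this file is PROVED (theorems only).

`ClassGroupLFunctionZeroFreeRegion.lean` shows that, with `c = c(n) > 0`, a zero `β + iγ` of
`L(s, χ)` (`χ ≠ 1` a class group character of a field `K` of degree `n`) with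
`β > 1 − c/(log|d_K| + log(|γ| + 4))` is a real zero of a real character. Here we add the two
"at most one" statements of Thorner–Zaman's Theorem 3.1 / Montgomery–Vaughan §11.1–11.2 (Case 4 of
Theorem 11.3 and Landau's Theorem 11.7), uniformly in the field, and `L(1, χ) ≠ 0`:

* abstract part, for any `UniformTwistedZFRData` (MV's proofs verbatim, at height `0`):
  `UniformTwistedZFRData.min_realZeros_le` — two DISTINCT real zeros `β₀ ≠ β₁` of `F` satisfy
  `min(β₀, β₁) ≤ 1 − c₄/(log Q + log 4)`, `c₄ = min(3η/64, 1/(6(K₀ + E + 1)))` (MV Theorem 11.3,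
  Case 4); `UniformTwistedZFRData.landau_min_le` — for three data with the same `Λ₀`, `Q` and
  parameters and twists satisfying Landau's positivity
  `Re[L(Λ₀,σ) + L(Λ₁⁽¹⁾,σ) + L(Λ₁⁽²⁾,σ) + L(Λ₁⁽¹²⁾,σ)] ≥ 0` (`σ > 1`), real zeros `β₁ < 1` of `F₁`
  and `β₂ < 1` of `F₂` satisfy `min(β₁, β₂) ≤ 1 − c₅/(log Q + log 4)`,
  `c₅ = min(3η/64, 1/(6(K₀ + 3E + 1)))` (MV Theorem 11.7);
* class group characters: `exists_prime_classGroupChar_ne_one` (a non-trivial `χ` is non-trivial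
  on some prime ideal: the prime ideals generate `Cl_K`), `classGroupLFunction₀_one_ne_zero` —
  **`L(1, χ) ≠ 0`** (the tree's Hecke–Landau theorem `rayClassLSeries_entire_apply_one_ne_zero`
  for `𝔪 = 1`); `landau_positivity_classGroupChar` — `Σ_𝔞 Λ(𝔞)(1 + χ₁(𝔞))(1 + χ₂(𝔞)) N𝔞^{-σ} ≥ 0`
  for real `χ₁, χ₂` (MV Lemma 11.6 over `K`);
  `exists_min_realZeros_classGroupLFunction₀_le` — **each `L(s, χ)`, `χ ≠ 1`, has at most one real
  zero (as a point) in `σ > 1 − c/(log|d_K| + log 4)`**, `c = c(n)`;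
  `exists_landau_classGroupLFunction₀` — **at most one real character `χ ≠ 1` of `K` has a real zero
  in `σ > 1 − c/(log|d_K| + log 4)`** (Landau–Page for the class group), `c = c(n)`.

Together with `exists_zeroFree_classGroupLFunction₀` this is [ThornerZaman2019, Theorem 3.1] for
the family `{L(s, χ) : χ ∈ Ĉl_K, χ ≠ 1}` (`L = H_K`), except for the simplicity of the exceptional
zero (multiplicities are not tracked by the Lemma-α package) and the factor `ζ_K` (`χ = 1`).

## References

* H. L. Montgomery, R. C. Vaughan, *Multiplicative Number Theory I*, CUP 2007, §11.1 Theorem 11.3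
  (proof, Case 4, p. 277), §11.2 Lemma 11.6 and Theorem 11.7 (p. 281). [MontgomeryVaughan2007]
* J. Thorner, A. Zaman, *A unified and improved Chebotarev density theorem*, ANT 13 (2019),
  Theorem 3.1. [ThornerZaman2019]
* K. Iwasawa, *Hecke's `L`-functions*, SpringerBriefs 2019, Prop. 4.4 (`L(1, χ) ≠ 0`). [Iwasawa2019]
-/

noncomputable section

open scoped NumberField nonZeroDivisors ComplexConjugate
open Complex Filter Topology Set Metric NumberField IsDedekindDomain

namespace Literature.NumberTheory.LFunctions

namespace UniformTwistedZFRData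

variable {η A Cg c₁ K₀ C₂ : ℝ} {pole : Bool} {Q : ℝ} {Λ₀ : ℕ → ℝ} {Λ₁ Λ₂ : ℕ → ℂ} {F : ℂ → ℂ}

/-- Local notation for the package constant `E(η, A, C_g, c₁) = 8(2A + |log(32C_g/(c₁η))| + 1)/(η/4)`. -/
local notation3 "E[" η "," A "," Cg "," c₁ "]" =>
  (8 * (2 * (A : ℝ) + |Real.log ((Cg : ℝ) / ((c₁ : ℝ) * ((η : ℝ) / 32)))| + 1) / ((η : ℝ) / 4))

/-! ### MV (11.2) at height `0` for a real zero -/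

/-- MV (11.2) at height `0`: for a real zero `β ≥ 1 − 7η/32` of `F` and `0 < δ ≤ 3η/32`,
`Re L(Λ₁, 1 + δ) ≤ E(log Q + log 4) − 1/(1 + δ − β)`. [cite: MontgomeryVaughan2007, Theorem 11.3 (proof, eq. (11.2))] -/
theorem re_LSeries₁_ofReal_le_of_realZero (h : UniformTwistedZFRData η A Cg c₁ K₀ C₂ pole Q Λ₀ Λ₁ Λ₂ F)
    {E : ℝ}
    (hpack : ∀ t : ℝ, ∃ (S : Finset ℂ) (m : ℂ → ℕ) (ψ : ℂ → ℂ),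
      (∀ a ∈ S, F a = 0 ∧ 0 < m a ∧ ‖a - (1 + η / 32 + t * I)‖ ≤ η / 4) ∧
      (∀ a, F a = 0 → ‖a - (1 + η / 32 + t * I)‖ ≤ η / 4 → a ∈ S) ∧
      (∀ z ∈ ball (1 + η / 32 + t * I) (η / 4), F z ≠ 0 →
        ψ z = deriv F z / F z - ∑ a ∈ S, (m a : ℂ) / (z - a)) ∧
      (∀ z ∈ closedBall (1 + η / 32 + t * I) (η / 16),
        ‖ψ z‖ ≤ E * (Real.log Q + Real.log (|t| + 4))))
    {β d : ℝ} (hzero : F β = 0) (hβ : 1 - 7 * η / 32 ≤ β) (hd : 0 < d) (hd1 : d ≤ 3 * η / 32) :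
    (LSeries Λ₁ ((1 + d : ℝ) : ℂ)).re ≤ E * (Real.log Q + Real.log 4) - 1 / (1 + d - β) := by
  have hz : F (β + (0 : ℝ) * I) = 0 := by simpa using hzero
  have h1 := h.re_LSeries₁_le_of_zero hpack hz hβ hd hd1
  simpa using h1

/-- MV (11.2) at height `0`, no zero: `Re L(Λ₁, 1 + δ) ≤ E(log Q + log 4)` for `0 < δ ≤ 3η/32`.
[cite: MontgomeryVaughan2007, Theorem 11.3 (proof, eq. (11.2))] -/
theorem re_LSeries₁_ofReal_le (h : UniformTwistedZFRData η A Cg c₁ K₀ C₂ pole Q Λ₀ Λ₁ Λ₂ F)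
    {E : ℝ}
    (hpack : ∀ t : ℝ, ∃ (S : Finset ℂ) (m : ℂ → ℕ) (ψ : ℂ → ℂ),
      (∀ a ∈ S, F a = 0 ∧ 0 < m a ∧ ‖a - (1 + η / 32 + t * I)‖ ≤ η / 4) ∧
      (∀ a, F a = 0 → ‖a - (1 + η / 32 + t * I)‖ ≤ η / 4 → a ∈ S) ∧
      (∀ z ∈ ball (1 + η / 32 + t * I) (η / 4), F z ≠ 0 →
        ψ z = deriv F z / F z - ∑ a ∈ S, (m a : ℂ) / (z - a)) ∧
      (∀ z ∈ closedBall (1 + η / 32 + t * I) (η / 16),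
        ‖ψ z‖ ≤ E * (Real.log Q + Real.log (|t| + 4))))
    {d : ℝ} (hd : 0 < d) (hd1 : d ≤ 3 * η / 32) :
    (LSeries Λ₁ ((1 + d : ℝ) : ℂ)).re ≤ E * (Real.log Q + Real.log 4) := by
  have h1 := h.re_LSeries₁_le hpack hd hd1 0
  simpa using h1

/-! ### MV Theorem 11.3, Case 4: two real zeros of the same `F` -/

/-- **MV Theorem 11.3, Case 4 (abstract, uniform):** with the package at height `0` (constant
`E ≥ 0`), two distinct real zeros `β₀ ≠ β₁` of `F` satisfy
`min(β₀, β₁) ≤ 1 − min(3η/64, 1/(6(K₀ + E + 1)))/(log Q + log 4)`: at `σ = 1 + 2(1 − β)`,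
`β = min`, the two zeros contribute `≥ 2/(3(1−β))` to `Re Σ m(a)/(σ − a)`, while
`0 ≤ Re L(Λ₀,σ) + Re L(Λ₁,σ) ≤ 1/(2(1−β)) + (K₀ + E)ℒ₀ − 2/(3(1−β))`.
[cite: MontgomeryVaughan2007, Theorem 11.3 (proof, Case 4)] -/
theorem min_realZeros_le_of_package (h : UniformTwistedZFRData η A Cg c₁ K₀ C₂ pole Q Λ₀ Λ₁ Λ₂ F)
    {E : ℝ} (hE : 0 ≤ E)
    (hpack : ∀ t : ℝ, ∃ (S : Finset ℂ) (m : ℂ → ℕ) (ψ : ℂ → ℂ),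
      (∀ a ∈ S, F a = 0 ∧ 0 < m a ∧ ‖a - (1 + η / 32 + t * I)‖ ≤ η / 4) ∧
      (∀ a, F a = 0 → ‖a - (1 + η / 32 + t * I)‖ ≤ η / 4 → a ∈ S) ∧
      (∀ z ∈ ball (1 + η / 32 + t * I) (η / 4), F z ≠ 0 →
        ψ z = deriv F z / F z - ∑ a ∈ S, (m a : ℂ) / (z - a)) ∧
      (∀ z ∈ closedBall (1 + η / 32 + t * I) (η / 16),
        ‖ψ z‖ ≤ E * (Real.log Q + Real.log (|t| + 4))))
    {β₀ β₁ : ℝ} (h₀ : F β₀ = 0) (h₁ : F β₁ = 0) (hne : β₀ ≠ β₁) :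
    min β₀ β₁ ≤ 1 - min (3 * η / 64) (1 / (6 * (K₀ + E + 1))) / (Real.log Q + Real.log 4) := by
  have hη := h.eta_pos
  have hη1 := h.eta_le_one
  have hK₀ := h.K₀_nonneg
  have hQ := h.one_le_Q
  set ℒ₀ : ℝ := Real.log Q + Real.log 4 with hℒ₀
  have hℒ₀1 : 1 ≤ ℒ₀ := log_add_log_four_ge hQ
  have hℒ₀0 : 0 < ℒ₀ := by linarith
  set c : ℝ := min (3 * η / 64) (1 / (6 * (K₀ + E + 1))) with hcdef
  have hc0 : 0 < c := lt_min (by positivity) (by positivity)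
  have hcη : c ≤ 3 * η / 64 := min_le_left _ _
  have hcK : c ≤ 1 / (6 * (K₀ + E + 1)) := min_le_right _ _
  have hcℒ : c / ℒ₀ ≤ c := div_le_self hc0.le hℒ₀1
  -- wlog `β₀ ≤ β₁`
  wlog hle : β₀ ≤ β₁ generalizing β₀ β₁
  · rw [min_comm]; exact this h₁ h₀ hne.symm (le_of_not_ge hle)
  rw [min_eq_left hle]
  have hβ₁1 : β₁ ≤ 1 := by have := h.re_le_one_of_zero h₁; simpa using this
  have hlt : β₀ < β₁ := lt_of_le_of_ne hle hne
  set u : ℝ := 1 - β₀ with hu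
  have hu0 : 0 < u := by rw [hu]; linarith
  by_contra hcon
  rw [not_le] at hcon
  have hularge : u < c / ℒ₀ := by rw [hu]; linarith
  have husmall : u < 3 * η / 64 := by linarith
  -- `δ = 2u`
  set d : ℝ := 2 * u with hddef
  have hdpos : 0 < d := by positivity
  have hd1 : d ≤ 3 * η / 32 := by rw [hddef]; linarith
  have hd1' : d ≤ 1 := by linarith
  obtain ⟨S, m, ψ, hS, hS', hψ, hψb⟩ := hpack 0
  have hcc : (1 + η / 32 + ((0 : ℝ) : ℂ) * I : ℂ) = 1 + η / 32 := by simp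
  rw [hcc] at hS hS' hψ hψb
  set s₀ : ℂ := ((1 + d : ℝ) : ℂ) with hs₀
  have hs₀re : s₀.re = 1 + d := by simp [hs₀]
  have hs₀1 : 1 < s₀.re := by rw [hs₀re]; linarith
  have hs₀c : ‖s₀ - (1 + η / 32)‖ ≤ η / 16 := by
    have : s₀ - (1 + η / 32) = ((d - η / 32 : ℝ) : ℂ) := by rw [hs₀]; push_cast; ring
    rw [this, Complex.norm_real, Real.norm_eq_abs, abs_le]
    constructor <;> linarith
  have hs₀ball : s₀ ∈ ball (1 + (η : ℂ) / 32) (η / 4) := mem_ball_iff_norm.2 (by linarith)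
  have hs₀cl : s₀ ∈ closedBall (1 + (η : ℂ) / 32) (η / 16) := mem_closedBall_iff_norm.2 hs₀c
  have hFs₀ : F s₀ ≠ 0 := h.ne_zero s₀ hs₀1
  have hψs₀ := hψ s₀ hs₀ball hFs₀
  -- both zeros lie in the disc
  have hin : ∀ b : ℝ, β₀ ≤ b → b ≤ 1 → ‖(b : ℂ) - (1 + η / 32)‖ ≤ η / 4 := by
    intro b hb hb1
    have : (b : ℂ) - (1 + η / 32) = ((b - (1 + η / 32) : ℝ) : ℂ) := by push_cast; ring
    rw [this, Complex.norm_real, Real.norm_eq_abs, abs_le]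
    constructor <;> linarith
  have hρ₀S : (β₀ : ℂ) ∈ S := hS' _ h₀ (hin β₀ le_rfl (by linarith))
  have hρ₁S : (β₁ : ℂ) ∈ S := hS' _ h₁ (hin β₁ hle hβ₁1)
  have hneC : (β₀ : ℂ) ≠ (β₁ : ℂ) := fun h' ↦ hne (by exact_mod_cast h')
  have hSre : ∀ a ∈ S, a.re < s₀.re := by
    intro a ha
    have := h.re_le_one_of_zero (hS a ha).1
    rw [hs₀re]; linarith
  have hpair := DirichletZFR.re_sum_div_ge_pair hSre (fun a ha ↦ (hS a ha).2.1) hρ₀S hρ₁S hneC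
  have e₀ : ((s₀ - β₀)⁻¹).re = 1 / (d + u) := by
    have : s₀ - β₀ = ((d + u : ℝ) : ℂ) := by rw [hs₀, hu]; push_cast; ring
    rw [this, ← Complex.ofReal_inv, Complex.ofReal_re, one_div]
  have e₁ : ((s₀ - β₁)⁻¹).re = 1 / (1 + d - β₁) := by
    have : s₀ - β₁ = ((1 + d - β₁ : ℝ) : ℂ) := by rw [hs₀]; push_cast; ring
    rw [this, ← Complex.ofReal_inv, Complex.ofReal_re, one_div]
  rw [e₀, e₁] at hpair
  have h1' : 1 / (d + u) ≤ 1 / (1 + d - β₁) :=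
    div_le_div_of_nonneg_left zero_le_one (by linarith) (by linarith)
  -- `Re L(Λ₁, s₀) ≤ E ℒ₀ − 2/(d + u)`
  have hL : LSeries Λ₁ s₀ = -(ψ s₀ + ∑ a ∈ S, (m a : ℂ) / (s₀ - a)) := by
    rw [hψs₀, h.logDeriv_eq s₀ hs₀1]; ring
  have hB : (LSeries Λ₁ s₀).re ≤ E * ℒ₀ - 2 / (d + u) := by
    rw [hL, Complex.neg_re, Complex.add_re]
    have hψn := (Complex.abs_re_le_norm (ψ s₀)).trans (hψb s₀ hs₀cl)
    rw [abs_zero, zero_add] at hψn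
    have h2 : 2 / (d + u) = 1 / (d + u) + 1 / (d + u) := by ring
    rw [h2]
    linarith [neg_abs_le (ψ s₀).re, le_abs_self (ψ s₀).re]
  have hA := h.re_LSeries₀_le_of_pos hdpos hd1'
  have h114 := TwistedZFR.re_add_re_nonneg h.norm_le₁ h.summable (σ := 1 + d) (by linarith)
  -- combine: `0 ≤ 1/d + K₀ℒ₀ + Eℒ₀ − 2/(d+u)`
  have hkey : 2 / (d + u) - 1 / d ≤ (K₀ + E) * ℒ₀ := by
    have e : (LSeries Λ₁ (((1 + d : ℝ) : ℂ))).re = (LSeries Λ₁ s₀).re := by rw [hs₀]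
    rw [e] at h114
    linarith
  have hval : 2 / (d + u) - 1 / d = 1 / (6 * u) := by rw [hddef]; field_simp; norm_num
  rw [hval] at hkey
  -- `u ≥ 1/(6(K₀+E)ℒ₀) ≥ c/ℒ₀`
  have hc' : c * (6 * (K₀ + E + 1)) ≤ 1 := by
    rw [le_div_iff₀ (by positivity)] at hcK; linarith
  have hfinal : c / ℒ₀ ≤ u := by
    rw [div_le_iff₀ hℒ₀0]
    rw [div_le_iff₀ (by positivity)] at hkey
    nlinarith
  linarith

/-- **MV Theorem 11.3, Case 4 for the uniform datum**: two distinct real zeros `β₀ ≠ β₁` of `F`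
satisfy `min(β₀, β₁) ≤ 1 − c₄/(log Q + log 4)` with `c₄ = min(3η/64, 1/(6(K₀ + E(η,A,C_g,c₁) + 1)))`
depending only on the numeric parameters. [cite: MontgomeryVaughan2007, Theorem 11.3 (proof, Case 4)] -/
theorem min_realZeros_le (h : UniformTwistedZFRData η A Cg c₁ K₀ C₂ pole Q Λ₀ Λ₁ Λ₂ F)
    {β₀ β₁ : ℝ} (h₀ : F β₀ = 0) (h₁ : F β₁ = 0) (hne : β₀ ≠ β₁) :
    min β₀ β₁ ≤ 1 - min (3 * η / 64) (1 / (6 * (K₀ + E[η, A, Cg, c₁] + 1))) /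
      (Real.log Q + Real.log 4) :=
  h.min_realZeros_le_of_package h.packageConst_nonneg h.exists_package h₀ h₁ hne

/-! ### MV Theorem 11.7 (Landau): real zeros of two different twists -/

/-- **Landau's theorem (MV Theorem 11.7), abstract uniform form.** Let three data share
`η, A, C_g, c₁, K₀, C₂`, the conductor parameter `Q` and `Λ₀`, with twists `Λ₁⁽¹⁾, Λ₁⁽²⁾, Λ₁⁽¹²⁾`
satisfying Landau's positivity `Re[L(Λ₀,σ) + L(Λ₁⁽¹⁾,σ) + L(Λ₁⁽²⁾,σ) + L(Λ₁⁽¹²⁾,σ)] ≥ 0` for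
`σ > 1` (model: `(1 + χ₁)(1 + χ₂) ≥ 0`). If `β₁ < 1`, `β₂ < 1` are real zeros of `F₁`, `F₂`, then
`min(β₁, β₂) ≤ 1 − c₅/(log Q + log 4)`, `c₅ = min(3η/64, 1/(6(K₀ + 3E + 1)))`: at
`σ = 1 + 2(1 − β)`, `β = min`, MV (11.2) for the three twists gives
`0 ≤ 1/δ + K₀ℒ₀ + 3Eℒ₀ − 1/(σ − β₁) − 1/(σ − β₂) ≤ 1/(2(1−β)) + (K₀ + 3E)ℒ₀ − 2/(3(1−β))`.
[cite: MontgomeryVaughan2007, Theorem 11.7] -/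
theorem landau_min_le {pole₁ pole₂ pole₁₂ : Bool} {Λ₁ Λ₁' Λ₁'' Λ₂ Λ₂' Λ₂'' : ℕ → ℂ}
    {F₁ F₂ F₁₂ : ℂ → ℂ}
    (h₁ : UniformTwistedZFRData η A Cg c₁ K₀ C₂ pole₁ Q Λ₀ Λ₁ Λ₂ F₁)
    (h₂ : UniformTwistedZFRData η A Cg c₁ K₀ C₂ pole₂ Q Λ₀ Λ₁' Λ₂' F₂)
    (h₁₂ : UniformTwistedZFRData η A Cg c₁ K₀ C₂ pole₁₂ Q Λ₀ Λ₁'' Λ₂'' F₁₂)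
    (hpos : ∀ σ : ℝ, 1 < σ → 0 ≤ (LSeries (fun n ↦ (Λ₀ n : ℂ)) σ).re + (LSeries Λ₁ σ).re +
      (LSeries Λ₁' σ).re + (LSeries Λ₁'' σ).re)
    {β₁ β₂ : ℝ} (hz₁ : F₁ β₁ = 0) (hz₂ : F₂ β₂ = 0) (hβ₁ : β₁ < 1) (hβ₂ : β₂ < 1) :
    min β₁ β₂ ≤ 1 - min (3 * η / 64) (1 / (6 * (K₀ + 3 * E[η, A, Cg, c₁] + 1))) /
      (Real.log Q + Real.log 4) := by
  have hη := h₁.eta_pos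
  have hη1 := h₁.eta_le_one
  have hK₀ := h₁.K₀_nonneg
  have hQ := h₁.one_le_Q
  obtain ⟨E, hEdef⟩ : ∃ E : ℝ, E = E[η, A, Cg, c₁] := ⟨_, rfl⟩
  have hE : 0 ≤ E := by rw [hEdef]; exact h₁.packageConst_nonneg
  rw [← hEdef]
  have hpack₁ := h₁.exists_package
  have hpack₂ := h₂.exists_package
  have hpack₁₂ := h₁₂.exists_package
  rw [← hEdef] at hpack₁ hpack₂ hpack₁₂
  set ℒ₀ : ℝ := Real.log Q + Real.log 4 with hℒ₀
  have hℒ₀1 : 1 ≤ ℒ₀ := log_add_log_four_ge hQ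
  have hℒ₀0 : 0 < ℒ₀ := by linarith
  set c : ℝ := min (3 * η / 64) (1 / (6 * (K₀ + 3 * E + 1))) with hcdef
  have hc0 : 0 < c := lt_min (by positivity) (by positivity)
  have hcη : c ≤ 3 * η / 64 := min_le_left _ _
  have hcK : c ≤ 1 / (6 * (K₀ + 3 * E + 1)) := min_le_right _ _
  have hcℒ : c / ℒ₀ ≤ c := div_le_self hc0.le hℒ₀1
  -- wlog `β₁ ≤ β₂`
  wlog hle : β₁ ≤ β₂ generalizing β₁ β₂ pole₁ pole₂ Λ₁ Λ₁' Λ₂ Λ₂' F₁ F₂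
  · rw [min_comm]
    refine this h₂ h₁ (fun σ hσ ↦ ?_) hz₂ hz₁ hβ₂ hβ₁ hpack₂ hpack₁ (le_of_not_ge hle)
    have := hpos σ hσ; linarith
  rw [min_eq_left hle]
  set u : ℝ := 1 - β₁ with hu
  have hu0 : 0 < u := by rw [hu]; linarith
  by_contra hcon
  rw [not_le] at hcon
  have hularge : u < c / ℒ₀ := by rw [hu]; linarith
  have husmall : u < 3 * η / 64 := by linarith
  set d : ℝ := 2 * u with hddef
  have hdpos : 0 < d := by positivity
  have hd1 : d ≤ 3 * η / 32 := by rw [hddef]; linarith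
  have hd1' : d ≤ 1 := by linarith
  have hb₁ : 1 - 7 * η / 32 ≤ β₁ := by linarith
  have hb₂ : 1 - 7 * η / 32 ≤ β₂ := by linarith
  -- the four inequalities at `σ = 1 + d`
  have hA := h₁.re_LSeries₀_le_of_pos hdpos hd1'
  have hB₁ := h₁.re_LSeries₁_ofReal_le_of_realZero hpack₁ hz₁ hb₁ hdpos hd1
  have hB₂ := h₂.re_LSeries₁_ofReal_le_of_realZero hpack₂ hz₂ hb₂ hdpos hd1
  have hB₁₂ := h₁₂.re_LSeries₁_ofReal_le hpack₁₂ hdpos hd1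
  have hP := hpos (1 + d) (by linarith)
  -- the zero terms: `1/(1+d−β₁) = 1/(3u)`, `1/(1+d−β₂) ≥ 1/(3u)`
  have e₁ : 1 / (1 + d - β₁) = 1 / (3 * u) := by rw [hddef, hu]; ring_nf
  have e₂ : 1 / (3 * u) ≤ 1 / (1 + d - β₂) :=
    div_le_div_of_nonneg_left zero_le_one (by linarith) (by rw [hddef, hu]; linarith)
  rw [e₁] at hB₁
  have hkey : 2 / (3 * u) - 1 / d ≤ (K₀ + 3 * E) * ℒ₀ := by
    have h2 : 2 / (3 * u) = 1 / (3 * u) + 1 / (3 * u) := by ring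
    rw [h2]
    linarith
  have hval : 2 / (3 * u) - 1 / d = 1 / (6 * u) := by rw [hddef]; field_simp; norm_num
  rw [hval] at hkey
  have hc' : c * (6 * (K₀ + 3 * E + 1)) ≤ 1 := by
    rw [le_div_iff₀ (by positivity)] at hcK; linarith
  have hfinal : c / ℒ₀ ≤ u := by
    rw [div_le_iff₀ hℒ₀0]
    rw [div_le_iff₀ (by positivity)] at hkey
    nlinarith
  linarith

end UniformTwistedZFRData

/-! ## Class group characters -/

namespace NumberField

variable {K : Type*} [Field K] [NumberField K]

/-! ### `L(1, χ) ≠ 0` -/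

/-- A class group character which is trivial on (the classes of) all prime ideals is trivial: the
prime ideals generate `Cl_K`. [folklore] -/
theorem classGroupChar_eq_one_of_forall_prime {χ : ClassGroup (𝓞 K) →* ℂˣ}
    (h : ∀ v : HeightOneSpectrum (𝓞 K), classGroupCharPrimeValue χ v = 1) : χ = 1 := by
  -- `χ(mk0 I) = 1` for every nonzero ideal, by induction on the prime factorisation
  have key : ∀ I : Ideal (𝓞 K), ∀ hI : I ≠ ⊥,
      (χ (ClassGroup.mk0 ⟨I, mem_nonZeroDivisors_of_ne_zero hI⟩) : ℂ) = 1 := by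
    intro I
    induction I using UniqueFactorizationMonoid.induction_on_prime with
    | h₁ => intro hI; exact absurd rfl hI
    | h₂ J hJ =>
      intro hJ0
      have hJ1 : J = ⊤ := Ideal.isUnit_iff.mp hJ
      subst hJ1
      have : (⟨(⊤ : Ideal (𝓞 K)), mem_nonZeroDivisors_of_ne_zero hJ0⟩ : (Ideal (𝓞 K))⁰) = 1 := by
        apply Subtype.ext
        show (⊤ : Ideal (𝓞 K)) = ((1 : (Ideal (𝓞 K))⁰) : Ideal (𝓞 K))
        rw [OneMemClass.coe_one, Ideal.one_eq_top]
      rw [this]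
      simp
    | h₃ J p hJ hp ih =>
      intro hpJ
      have hp0 : p ≠ ⊥ := hp.ne_zero
      have hmul : (⟨p * J, mem_nonZeroDivisors_of_ne_zero hpJ⟩ : (Ideal (𝓞 K))⁰) =
          ⟨p, mem_nonZeroDivisors_of_ne_zero hp0⟩ * ⟨J, mem_nonZeroDivisors_of_ne_zero hJ⟩ := by
        ext1; rfl
      rw [hmul, map_mul, map_mul, Units.val_mul, ih hJ, mul_one]
      -- `p` is a prime ideal: a `HeightOneSpectrum` point
      have hprime : p.IsPrime := Ideal.isPrime_of_prime hp
      have := h ⟨p, hprime, hp0⟩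
      simpa [classGroupCharPrimeValue] using this
  refine MonoidHom.ext fun C ↦ ?_
  obtain ⟨I, rfl⟩ := ClassGroup.mk0_surjective C
  have hI : (I : Ideal (𝓞 K)) ≠ ⊥ := nonZeroDivisors.ne_zero I.2
  have := key I hI
  have hI' : (⟨(I : Ideal (𝓞 K)), mem_nonZeroDivisors_of_ne_zero hI⟩ : (Ideal (𝓞 K))⁰) = I := by ext1; rfl
  rw [hI'] at this
  exact Units.val_eq_one.mp this

/-- A non-trivial class group character is `≠ 1` on some prime ideal. [folklore] -/
theorem exists_prime_classGroupChar_ne_one {χ : ClassGroup (𝓞 K) →* ℂˣ} (hχ : χ ≠ 1) :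
    ∃ v : HeightOneSpectrum (𝓞 K), ¬ (⊤ : Ideal (𝓞 K)) ≤ v.asIdeal ∧ classGroupCharPrimeValue χ v ≠ 1 := by
  by_contra hcon
  refine hχ (classGroupChar_eq_one_of_forall_prime fun v ↦ ?_)
  by_contra hv
  exact hcon ⟨v, fun hle ↦ v.isPrime.ne_top (top_le_iff.mp hle), hv⟩

/-- **`L(1, χ) ≠ 0` for a non-trivial class group character** (Hecke 1917 / Landau 1918): the
entire function `L₀(·, χ)` does not vanish at `s = 1` — the tree's
`rayClassLSeries_entire_apply_one_ne_zero` (`𝔪 = 1`) for the continuation `L₀`, which agrees with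
`rayClassLSeries ⊤ ψ_χ = L(s, χ)` on `Re s > 1`. [cite: Iwasawa2019, Ch. 4 §4.2 Prop. 4.4] -/
theorem classGroupLFunction₀_one_ne_zero {χ : ClassGroup (𝓞 K) →* ℂˣ} (hχ : χ ≠ 1) :
    classGroupLFunction₀ K χ 1 ≠ 0 := by
  refine rayClassLSeries_entire_apply_one_ne_zero (𝔪 := ⊤) top_ne_bot (isRayClassCharacter_top χ)
    (exists_prime_classGroupChar_ne_one hχ) (differentiable_classGroupLFunction₀ χ) fun s hs ↦ ?_
  have hs1 : s ≠ 1 := fun h ↦ by rw [h, one_re] at hs; exact lt_irrefl _ hs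
  rw [classGroupLFunction₀_eq χ hs1 hχ, rayClassLSeries_top_eq_classGroupLFunction K χ hs]

/-- A real zero of `L₀(·, χ)`, `χ ≠ 1`, is `< 1`. [folklore] -/
theorem realZero_lt_one {χ : ClassGroup (𝓞 K) →* ℂˣ} (hχ : χ ≠ 1) {β : ℝ}
    (hβ : classGroupLFunction₀ K χ β = 0) : β < 1 := by
  have hle : β ≤ 1 := by
    by_contra h
    rw [not_le] at h
    have hs : 1 < ((β : ℂ)).re := by simpa using h
    have hs1 : (β : ℂ) ≠ 1 := fun h' ↦ by rw [h', one_re] at hs; exact lt_irrefl _ hs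
    rw [classGroupLFunction₀_eq χ hs1 hχ] at hβ
    exact classGroupLFunction_ne_zero_of_one_lt_re K χ hs hβ
  rcases hle.lt_or_eq with h | h
  · exact h
  · exfalso
    rw [h, Complex.ofReal_one] at hβ
    exact classGroupLFunction₀_one_ne_zero hχ hβ

/-! ### Landau's positivity `(1 + χ₁)(1 + χ₂) ≥ 0` -/

/-- `ν_{χ₁χ₂} = ν_{χ₁} ν_{χ₂}` pointwise. [folklore] -/
theorem classGroupCharIdealHom_mul (χ₁ χ₂ : ClassGroup (𝓞 K) →* ℂˣ) (I : Ideal (𝓞 K)) :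
    classGroupCharIdealHom (χ₁ * χ₂) I = classGroupCharIdealHom χ₁ I * classGroupCharIdealHom χ₂ I := by
  by_cases hI : I = ⊥
  · rw [hI, classGroupCharIdealHom_bot, classGroupCharIdealHom_bot, zero_mul]
  · rw [classGroupCharIdealHom_apply_of_ne_bot _ hI, classGroupCharIdealHom_apply_of_ne_bot _ hI,
      classGroupCharIdealHom_apply_of_ne_bot _ hI, MonoidHom.mul_apply, Units.val_mul]

/-- For a real character, `ν_χ(𝔞) ∈ {0, 1, −1}`; in particular `ν_χ(𝔞) = Re ν_χ(𝔞)` with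
`−1 ≤ Re ν_χ(𝔞) ≤ 1`. [folklore] -/
theorem classGroupCharIdealHom_eq_re_of_real {χ : ClassGroup (𝓞 K) →* ℂˣ} (h2 : χ * χ = 1)
    (I : Ideal (𝓞 K)) :
    classGroupCharIdealHom χ I = ((classGroupCharIdealHom χ I).re : ℂ) ∧
      -1 ≤ (classGroupCharIdealHom χ I).re ∧ (classGroupCharIdealHom χ I).re ≤ 1 := by
  by_cases hI : I = ⊥
  · rw [hI, classGroupCharIdealHom_bot]; simp
  · rw [classGroupCharIdealHom_apply_of_ne_bot _ hI]
    rcases classGroupChar_apply_eq_one_or_eq_neg_one h2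
      (ClassGroup.mk0 ⟨I, mem_nonZeroDivisors_of_ne_zero hI⟩) with h | h <;>
    · rw [h]; norm_num

/-- The terms of `L(Λ_K,σ) + L(Λ_{χ₁},σ) + L(Λ_{χ₂},σ) + L(Λ_{χ₁χ₂},σ)` at real `σ` have
non-negative real part: `n^{-σ} Σ_{N𝔞 = n} Λ(𝔞)(1 + χ₁(𝔞))(1 + χ₂(𝔞)) ≥ 0` for real `χ₁, χ₂`.
[cite: MontgomeryVaughan2007, Lemma 11.6] -/
theorem re_landau_terms_nonneg {χ₁ χ₂ : ClassGroup (𝓞 K) →* ℂˣ} (h₁ : χ₁ * χ₁ = 1) (h₂ : χ₂ * χ₂ = 1)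
    (σ : ℝ) (n : ℕ) :
    0 ≤ (LSeries.term (fun n ↦ (vonMangoldtNorm K n : ℂ)) σ n).re +
      (LSeries.term (twistVonMangoldt K (classGroupCharIdealHom χ₁)) σ n).re +
      (LSeries.term (twistVonMangoldt K (classGroupCharIdealHom χ₂)) σ n).re +
      (LSeries.term (twistVonMangoldt K (classGroupCharIdealHom (χ₁ * χ₂))) σ n).re := by
  rcases eq_or_ne n 0 with rfl | hn
  · simp
  set r : ℝ := ((n : ℝ) ^ σ)⁻¹ with hr
  have hr0 : 0 ≤ r := by positivity
  have hterm : ∀ f : ℕ → ℂ, LSeries.term f σ n = (r : ℂ) * f n := by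
    intro f
    have := term_eq_inv_rpow_mul f σ 0 hn
    simp only [Complex.ofReal_zero, zero_mul, add_zero, neg_zero, Complex.cpow_zero, mul_one] at this
    rw [this, hr]
  rw [hterm, hterm, hterm, hterm, Complex.re_ofReal_mul, Complex.re_ofReal_mul, Complex.re_ofReal_mul,
    Complex.re_ofReal_mul, ← mul_add, ← mul_add, ← mul_add]
  refine mul_nonneg hr0 ?_
  -- the bracket as a sum over ideals of norm `n`
  have hsum : ((vonMangoldtNorm K n : ℂ)).re + (twistVonMangoldt K (classGroupCharIdealHom χ₁) n).re +
      (twistVonMangoldt K (classGroupCharIdealHom χ₂) n).re +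
      (twistVonMangoldt K (classGroupCharIdealHom (χ₁ * χ₂)) n).re =
      ∑ B ∈ idealsOfNorm K n, idealVonMangoldt B *
        ((1 + (classGroupCharIdealHom χ₁ B).re) * (1 + (classGroupCharIdealHom χ₂ B).re)) := by
    unfold vonMangoldtNorm twistVonMangoldt
    rw [Complex.ofReal_re, Complex.re_sum, Complex.re_sum, Complex.re_sum, ← Finset.sum_add_distrib,
      ← Finset.sum_add_distrib, ← Finset.sum_add_distrib]
    refine Finset.sum_congr rfl fun B _ ↦ ?_
    obtain ⟨e₁, -, -⟩ := classGroupCharIdealHom_eq_re_of_real h₁ B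
    obtain ⟨e₂, -, -⟩ := classGroupCharIdealHom_eq_re_of_real h₂ B
    set a : ℝ := (classGroupCharIdealHom χ₁ B).re with ha
    set b : ℝ := (classGroupCharIdealHom χ₂ B).re with hb
    rw [classGroupCharIdealHom_mul, e₁, e₂]
    simp only [← Complex.ofReal_mul, Complex.ofReal_re]
    ring
  rw [hsum]
  refine Finset.sum_nonneg fun B _ ↦ mul_nonneg (idealVonMangoldt_nonneg B) ?_
  obtain ⟨-, ha, -⟩ := classGroupCharIdealHom_eq_re_of_real h₁ B
  obtain ⟨-, hb, -⟩ := classGroupCharIdealHom_eq_re_of_real h₂ B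
  exact mul_nonneg (by linarith) (by linarith)

/-- **MV Lemma 11.6 over `K`**: for real class group characters `χ₁, χ₂` and real `σ > 1`,
`Re[L(Λ_K,σ) + L(Λ_{χ₁},σ) + L(Λ_{χ₂},σ) + L(Λ_{χ₁χ₂},σ)] = Σ_𝔞 Λ(𝔞)(1+χ₁(𝔞))(1+χ₂(𝔞))N𝔞^{-σ} ≥ 0`.
[cite: MontgomeryVaughan2007, Lemma 11.6] -/
theorem landau_positivity_classGroupChar {χ₁ χ₂ : ClassGroup (𝓞 K) →* ℂˣ} (h₁ : χ₁ * χ₁ = 1)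
    (h₂ : χ₂ * χ₂ = 1) {σ : ℝ} (hσ : 1 < σ) :
    0 ≤ (LSeries (fun n ↦ (vonMangoldtNorm K n : ℂ)) σ).re +
      (LSeries (twistVonMangoldt K (classGroupCharIdealHom χ₁)) σ).re +
      (LSeries (twistVonMangoldt K (classGroupCharIdealHom χ₂)) σ).re +
      (LSeries (twistVonMangoldt K (classGroupCharIdealHom (χ₁ * χ₂))) σ).re := by
  have hs1 : 1 < (σ : ℂ).re := by simp [hσ]
  have hA := (LSeriesSummable_vonMangoldtNorm (K := K) hs1).hasSum
  have hB := (LSeriesSummable_twistVonMangoldt (norm_classGroupCharIdealHom_le χ₁) hs1).hasSum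
  have hC := (LSeriesSummable_twistVonMangoldt (norm_classGroupCharIdealHom_le χ₂) hs1).hasSum
  have hD := (LSeriesSummable_twistVonMangoldt (norm_classGroupCharIdealHom_le (χ₁ * χ₂)) hs1).hasSum
  have hsum := (((hA.add hB).add hC).add hD).mapL Complex.reCLM
  simp only [Complex.reCLM_apply, Complex.add_re] at hsum
  exact hsum.nonneg fun n ↦ re_landau_terms_nonneg h₁ h₂ σ n

/-! ### The two "at most one" theorems -/

/-- **At most one real zero of `L(s, χ)` near `1`, uniformly in the field** (MV Theorem 11.3,
Case 4, for class group characters; part of [ThornerZaman2019, Theorem 3.1]): for every `n` there is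
`c = c(n) > 0` such that for every `K` of degree `n`, every class group character `χ ≠ 1` and two
distinct real zeros `β₀ ≠ β₁` of `L₀(s, χ)`, `min(β₀, β₁) ≤ 1 − c/(log|d_K| + log 4)`.
[cite: MontgomeryVaughan2007, Theorem 11.3 (proof, Case 4)] -/
theorem exists_min_realZeros_classGroupLFunction₀_le (n : ℕ) :
    ∃ c : ℝ, 0 < c ∧ ∀ (K : Type) [Field K] [NumberField K], Module.finrank ℚ K = n →
      ∀ χ : ClassGroup (𝓞 K) →* ℂˣ, χ ≠ 1 → ∀ β₀ β₁ : ℝ, β₀ ≠ β₁ →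
        classGroupLFunction₀ K χ β₀ = 0 → classGroupLFunction₀ K χ β₁ = 0 →
          min β₀ β₁ ≤ 1 - c / (Real.log ((discr K).natAbs : ℝ) + Real.log 4) := by
  obtain ⟨hA, -, -, hK₀, -⟩ := zfrParams_nonneg n
  set η : ℝ := 1
  set A : ℝ := (n : ℝ) + 1 with hAdef
  set Cg : ℝ := 2 * Real.exp (2 * n) * (3 / 2) ^ (n + 1) with hCg
  set c₁ : ℝ := 32 * Real.exp (-(32 * n)) with hc₁
  set K₀ : ℝ := 77760 * (5 * n + 2) with hK₀def
  set E : ℝ := 8 * (2 * A + |Real.log (Cg / (c₁ * ((1 : ℝ) / 32)))| + 1) / ((1 : ℝ) / 4) with hE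
  have hE0 : 0 ≤ E := by rw [hE]; positivity
  set c : ℝ := min (3 * (1 : ℝ) / 64) (1 / (6 * (K₀ + E + 1))) with hcdef
  have hc : 0 < c := lt_min (by norm_num) (by positivity)
  refine ⟨c, hc, fun K _ _ hK χ hχ β₀ β₁ hne h₀ h₁ ↦ ?_⟩
  subst hK
  by_cases h2 : χ * χ = 1
  · have hdat := uniformTwistedZFRData_classGroupLFunction₀_of_eq hχ h2
    have := hdat.min_realZeros_le h₀ h₁ hne
    simpa [hcdef, hE, hAdef, hCg, hc₁, hK₀def] using this
  · have hdat := uniformTwistedZFRData_classGroupLFunction₀_of_ne h2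
    have := hdat.min_realZeros_le h₀ h₁ hne
    simpa [hcdef, hE, hAdef, hCg, hc₁, hK₀def] using this

/-- **Landau–Page for the class group, uniformly in the field** (MV Theorem 11.7 for class group
characters; the "at most one exceptional character" clause of [ThornerZaman2019, Theorem 3.1]): for
every `n` there is `c = c(n) > 0` such that for every `K` of degree `n`, two DISTINCT real class
group characters `χ₁ ≠ χ₂` (both `≠ 1`) and real zeros `β₁` of `L₀(s, χ₁)`, `β₂` of `L₀(s, χ₂)`,
`min(β₁, β₂) ≤ 1 − c/(log|d_K| + log 4)`. [cite: MontgomeryVaughan2007, Theorem 11.7] -/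
theorem exists_landau_classGroupLFunction₀ (n : ℕ) :
    ∃ c : ℝ, 0 < c ∧ ∀ (K : Type) [Field K] [NumberField K], Module.finrank ℚ K = n →
      ∀ χ₁ χ₂ : ClassGroup (𝓞 K) →* ℂˣ, χ₁ ≠ 1 → χ₂ ≠ 1 → χ₁ * χ₁ = 1 → χ₂ * χ₂ = 1 → χ₁ ≠ χ₂ →
        ∀ β₁ β₂ : ℝ, classGroupLFunction₀ K χ₁ β₁ = 0 → classGroupLFunction₀ K χ₂ β₂ = 0 →
          min β₁ β₂ ≤ 1 - c / (Real.log ((discr K).natAbs : ℝ) + Real.log 4) := by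
  obtain ⟨hA, -, -, hK₀, -⟩ := zfrParams_nonneg n
  set A : ℝ := (n : ℝ) + 1 with hAdef
  set Cg : ℝ := 2 * Real.exp (2 * n) * (3 / 2) ^ (n + 1) with hCg
  set c₁ : ℝ := 32 * Real.exp (-(32 * n)) with hc₁
  set K₀ : ℝ := 77760 * (5 * n + 2) with hK₀def
  set E : ℝ := 8 * (2 * A + |Real.log (Cg / (c₁ * ((1 : ℝ) / 32)))| + 1) / ((1 : ℝ) / 4) with hE
  have hE0 : 0 ≤ E := by rw [hE]; positivity
  set c : ℝ := min (3 * (1 : ℝ) / 64) (1 / (6 * (K₀ + 3 * E + 1))) with hcdef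
  have hc : 0 < c := lt_min (by norm_num) (by positivity)
  refine ⟨c, hc, fun K _ _ hK χ₁ χ₂ hχ₁ hχ₂ h₁ h₂ hne β₁ β₂ hz₁ hz₂ ↦ ?_⟩
  subst hK
  -- `χ₁χ₂` is real and non-trivial
  have h12 : χ₁ * χ₂ ≠ 1 := by
    intro h
    refine hne (MonoidHom.ext fun C ↦ ?_)
    have a := DFunLike.congr_fun h C
    have b := DFunLike.congr_fun h₂ C
    simp only [MonoidHom.mul_apply, MonoidHom.one_apply] at a b
    rw [eq_inv_of_mul_eq_one_left a, ← eq_inv_of_mul_eq_one_left b]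
  have h12sq : (χ₁ * χ₂) * (χ₁ * χ₂) = 1 := by
    refine MonoidHom.ext fun C ↦ ?_
    have a := DFunLike.congr_fun h₁ C
    have b := DFunLike.congr_fun h₂ C
    simp only [MonoidHom.mul_apply, MonoidHom.one_apply] at a b ⊢
    calc χ₁ C * χ₂ C * (χ₁ C * χ₂ C) = (χ₁ C * χ₁ C) * (χ₂ C * χ₂ C) := mul_mul_mul_comm _ _ _ _
      _ = 1 := by rw [a, b, one_mul]
  have hd₁ := uniformTwistedZFRData_classGroupLFunction₀_of_eq hχ₁ h₁
  have hd₂ := uniformTwistedZFRData_classGroupLFunction₀_of_eq hχ₂ h₂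
  have hd₁₂ := uniformTwistedZFRData_classGroupLFunction₀_of_eq h12 h12sq
  have hlt₁ := realZero_lt_one hχ₁ hz₁
  have hlt₂ := realZero_lt_one hχ₂ hz₂
  have := UniformTwistedZFRData.landau_min_le hd₁ hd₂ hd₁₂
    (fun σ hσ ↦ landau_positivity_classGroupChar h₁ h₂ hσ) hz₁ hz₂ hlt₁ hlt₂
  simpa [hcdef, hE, hAdef, hCg, hc₁, hK₀def] using this

end NumberField

end Literature.NumberTheory.LFunctions

end
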